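/-
Copyright (c) 2026 the pub-hodgecm-mathlib formalisation cell (harness21).  Prover seat hodgecm-mathlib-LH7-p08 (g3) (hand lent to squad K2 ∕ K2Liu):
Track B «K2-LIT», hLiu418 = stmt-HodgeConjecture-24832, LEAD F0P6-plan (g16) BATCH #274 (1) ∕ #275 (1) deal of record 2026-09-05T03:09:58Z = organ B3-1
of road (B3) GLOBAL UNFOLDING for the theta side of FACE-D₀ (`hsign₂′`, `hloc₂′`); FACE-D₀ desk K2Liu-p02 (g10); 2026-09-05.
-/
import Summits.HodgeConjecture.HodgeConjecture.Theorems.K2LiuSiegelFourierCoeffDelta     -- ★ (A2) `integral_wt_smul_unipDeltaChar_eq_zero`, identity cell (+ ★ (A1), ★ (D), ★ O41.4)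
import Summits.HodgeConjecture.HodgeConjecture.Theorems.K2LiuSiegelEisensteinCoeffCells  -- ★ Φ2 (T2′) `exists_unipDeltaChar_ne_one_of_ne_zero` (the witness from ★ (A1) injectivity)
import HarnessLib

/-!
# Crux `HLiu418`, road (B3) GLOBAL UNFOLDING, organ B3-1: ORTHOGONALITY OF THE UNIPOTENT CHARACTERS `ψ_S` AGAINST A COVERING WEIGHT —
# `∫ β(u) • ψ_S(u) dνN(u) = δ_{S,0} · ∫ β dνN` and `∫ β(u) • (conj ψ_S(u) · ψ_{S'}(u)) dνN(u) = δ_{S,S'} · ∫ β dνN` for rational `T_L`-skew indices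

Cell `hodgecm-mathlib`, crux item hLiu418 = `stmt-HodgeConjecture-24832`, route of record `HCCMUnconditional`; squad K2 ∕ K2Liu, LEAD F0P6-plan (g16)
(BATCH #274 (1), #275 (1): road (B3) = B3-1 this file → B3-2 `K2LiuDoubledLineThetaCoeffUnfolding :: cf_thetaSide_eq_integral_latticeSum` (K2E3-p37 (g4)) →
B3-3 `K2LiuThetaSideRankOneIndexGlobalGram` (K2Liu-p02 (g10)) → (α) `K2LiuRankOneLettersOfGlobalGram :: hloc_hsign_of_globalGram` (K2E3-p37 (g4))),
FACE-D₀ desk K2Liu-p02 (g10), prover LH7-p08 (g3).  THEOREMS ONLY (no `def`, no instance, no notation, no named-fact hypothesis, no `sorry`, default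
heartbeats); lane `--supports stmt-HodgeConjecture-24832 --as helper` (count-neutral).

SETTING (★ (D) `K2LiuSiegelUnipotentFourierDefs`, ★ (A1) `K2LiuSiegelUnipotentCharacters`, ★ (A2) `K2LiuSiegelFourierCoeffDelta`, ★ Lit
`MeasureTheory/Group/CoveringWeights{,Bochner}`).  `N_Δ(𝔸) = ↥unipDelta` is the (commutative) unipotent radical of the Siegel parabolic of
`H(𝔸) = U(𝕍 ⊕ −𝕍)(𝔸_{L⁺})`, `N_Δ(L⁺) = ↥unipDeltaRat` its rational lattice acting by left multiplication, `νN` a left-invariant measure on `N_Δ(𝔸)`,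
`β : N_Δ(𝔸) → [0, ∞]` an `N_Δ(L⁺)`-COVERING WEIGHT (★ `IsCoveringWeight`: measurable, `Σ_γ β(γu) = 1`; ★ `K2LiuUnipotentCoveringWeight` produces one of
compact support and finite mass), so that `∫_{N_Δ(𝔸)} β(u) • F(u) dνN(u)` IS the integral of a left-`N_Δ(L⁺)`-invariant `F` over the compact quotient
`N_Δ(L⁺)\N_Δ(𝔸)` against the image of `νN` (★ weight independence) — the currency of ★ O41.4 and of ★ (D) `fourierCoeffDelta`.  The characters are
`ψ_S(u) = ψ_L(tr(S_𝔸 X(u)))` (★ `unipDeltaChar`), `S ∈ M_n(L)`; on the INDEX GROUP `Skew_{T_L}(L) = skewMatrices c T_L` (`T_L = gramR ⊗ L`) the family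
`S ↦ ψ_S|_{N_Δ(𝔸)}` is additive, trivial on `N_Δ(L⁺)`, and INJECTIVE (★ (A1) `eq_zero_of_forall_unipDeltaChar_eq_one`, under `dV i ≠ 0`, `dW i ≠ 0`).

WHAT THIS FILE PROVES (all corollaries of ★ (A2) `integral_wt_smul_unipDeltaChar_eq_zero` — «`∫ β • ψ_S dνN = 0` as soon as `ψ_S(u₀) ≠ 1` for
some `u₀`» — composed with ★ (A1) injectivity, which supplies the witness `u₀` for every rational skew `S ≠ 0`; stated BY NAME in the index-keyed
shapes the unfolding B3-2 consumes).
* §1 index side: `forall_unipDeltaChar_eq_one_iff` (`ψ_S ≡ 1 on N_Δ(𝔸) ↔ S = 0`; the witness form `∃ u₀, ψ_S(u₀) ≠ 1` for `S ≠ 0` is ★ Φ2 (T2′)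
  `K2LiuSiegelEisensteinCoeffCells.exists_unipDeltaChar_ne_one_of_ne_zero`, cited, not restated) and the algebra `conj ψ_S · ψ_{S'} = ψ_{S'−S}`
  (`conj_unipDeltaChar_mul_unipDeltaChar`).
* §2 twisted volumes: `integral_wt_smul_one`, `integral_wt_smul_eq_of_forall_eq_one`, `integral_wt_smul_unipDeltaChar_zero` (`= vol := ∫ β dνN`),
  `integral_wt_smul_unipDeltaChar_eq_zero_of_ne_zero` (`= 0` for skew `S ≠ 0`), the HEADLINE **`integral_coveringWeight_mul_unipDeltaChar`**
  `∫ β(u) • ψ_S(u) dνN = if S = 0 then vol else 0` (and its `*`-currency and `conj`-twins).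
* §3 ORTHOGONALITY RELATIONS **`integral_wt_smul_conj_unipDeltaChar_mul_unipDeltaChar`** `∫ β • (conj ψ_S · ψ_{S'}) dνN = if S = S' then vol else 0`
  and the normalised summand form `average_wt_smul_conj_unipDeltaChar_mul_unipDeltaChar_mul` (`(vol)⁻¹ • ∫ β • (conj ψ_S · (ψ_{S'} · c)) = if S = S' then c else 0`).
* §4 the index-keyed IDENTITY CELL `fourierCoeffDelta_of_forall_mul_eq_ite`: a left-`N_Δ(𝔸)`-invariant slice has `φ_S(h) = if S = 0 then φ(h) else 0`.
* §5 an integrability organ for the Fubini step of B3-2: `integrable_wt_smul_of_norm_le` (bounded a.e.-strongly-measurable slice, finite-mass weight;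
  no compact-support hypothesis) and its `conj ψ_S · G` instance.
Kronecker deltas carry an explicit `[Decidable (…)]` binder (consumers: `classical`); the `if`-free split forms are stated alongside.
Classical shape: orthogonality of characters of the compact abelian group `N_Δ(L⁺)\N_Δ(𝔸) ≅ (L\𝔸_L)^{…}`, [MoeglinWaldspurger1995, I.2.6],
[Shimura1997, §18.1], [Tan1999, §3], [KudlaRallis1994, §2].

NOT CLAIMED HERE: the Fourier EXPANSION `φ(uh) = Σ_S φ_S(h) ψ_S(u)` (★ `K2LiuSiegelFourierExpansionDelta`), the unfolding of the doubled line theta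
lift (B3-2), anything archimedean.
HONEST LABEL.  Count-neutral helper (S-sized corollary file); `HC_CM` is proved only modulo the 7 printed citations (2 remaining named inputs:
hLiu418 = `stmt-HodgeConjecture-24832`, h413 = `stmt-HodgeConjecture-24833`) until rung 0 closes.

## References
* [MoeglinWaldspurger1995] C. Mœglin, J.-L. Waldspurger, *Spectral decomposition and Eisenstein series*, CUP (1995): I.2.6 (Fourier expansion along an
  abelian unipotent radical; orthogonality of the characters of `N(k)\N(𝔸)`), II.1.7.
* [Shimura1997] G. Shimura, *Euler products and Eisenstein series*, CBMS 93 (1997): §18.1 (`e(tr(hx))`, `h` hermitian).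
* [Tan1999] V. Tan, *Poles of Siegel Eisenstein series on U(n,n)*, Canad. J. Math. 51 (1999): §3.
* [KudlaRallis1994] S. Kudla, S. Rallis, *A regularized Siegel–Weil formula: the first term identity*, Ann. of Math. 140 (1994): §2.
* [Weil1964] A. Weil, *Sur certains groupes d'opérateurs unitaires*, Acta Math. 111 (1964): n° 13 (characters of `X_k\X_A`).
-/

set_option autoImplicit false
set_option linter.dupNamespace false -- the mandated namespace repeats `HodgeConjecture.HodgeConjecture`

noncomputable section

open scoped Matrix ENNReal NNReal ComplexConjugate
open NumberField IsDedekindDomain MeasureTheory MeasureTheory.Measure Filter Set Function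
open Literature.NumberTheory.Automorphic Literature.NumberTheory.Automorphic.UnitaryGroup Literature.NumberTheory.GaloisRepresentations
open Literature.NumberTheory.GelbartRogawski1991 Literature.NumberTheory.GelbartRogawski1991.GRConstruction
open Literature.NumberTheory.K2Lit.SiegelDoubled Literature.MeasureTheory.Group

namespace Summit.HodgeConjecture.HodgeConjecture.Cruxes.HLiu418.K2LiuCoveringWeightCharacterOrthogonality

open K2LiuSiegelUnipotentFourierDefs K2LiuSiegelUnipotentCharacters K2LiuUnipotentCoveringWeight K2LiuSiegelFourierCoeffDelta
open K2LiuSiegelEisensteinCoeffCells (exists_unipDeltaChar_ne_one_of_ne_zero)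

variable (L : Type) [Field L] [NumberField L] [IsCMField L]
variable {N M n : ℕ} (e : Fin N × Fin M ≃ Fin n)
  (dV : Fin N → L) (hdV : ∀ i, IsCMField.complexConj L (dV i) = dV i)
  (dW : Fin M → L) (hdW : ∀ i, IsCMField.complexConj L (dW i) = dW i)

/-! ## §1 The index side: `ψ_S ≡ 1 ↔ S = 0` on rational skew indices; `conj ψ_S · ψ_{S'} = ψ_{S'−S}` -/

/-- **`ψ_S ≡ 1` on `N_Δ(𝔸)` iff `S = 0`**, for a rational `T_L`-skew index `S` (★ (A1) INJECTIVITY `eq_zero_of_forall_unipDeltaChar_eq_one`; `ψ_0 = 1`).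
[cite: Tan1999, §3] [cite: MoeglinWaldspurger1995, I.2.6] -/
theorem forall_unipDeltaChar_eq_one_iff (hdV0 : ∀ i, dV i ≠ 0) (hdW0 : ∀ i, dW i ≠ 0) {S : Matrix (Fin n) (Fin n) L}
    (hS : S ∈ skewMatrices ((IsCMField.complexConj L : L ≃ₐ[Fp L] L) : L →+* L) ((gramR L e dV hdV dW hdW).map (algebraMap (Fp L) L))) :
    (∀ u : unipDelta L e dV hdV dW hdW, unipDeltaChar L e dV hdV dW hdW S (u : HA L e dV hdV dW hdW) = 1) ↔ S = 0 := by
  refine ⟨fun h => eq_zero_of_forall_unipDeltaChar_eq_one L e dV hdV dW hdW hdV0 hdW0 hS fun u hu => h ⟨u, hu⟩, ?_⟩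
  rintro rfl u
  exact unipDeltaChar_zero L e dV hdV dW hdW _

/-- **`conj ψ_S(u) · ψ_{S'}(u) = ψ_{S'−S}(u)`** (`conj ψ_S = ψ_{−S}`, additivity in the index; all `u ∈ H(𝔸)`). [cite: Shimura1997, §18.1] -/
theorem conj_unipDeltaChar_mul_unipDeltaChar (S S' : Matrix (Fin n) (Fin n) L) (u : HA L e dV hdV dW hdW) :
    conj (unipDeltaChar L e dV hdV dW hdW S u : ℂ) * (unipDeltaChar L e dV hdV dW hdW S' u : ℂ) =
      (unipDeltaChar L e dV hdV dW hdW (S' - S) u : ℂ) := by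
  rw [← coe_unipDeltaChar_neg, ← Circle.coe_mul, ← unipDeltaChar_add, neg_add_eq_sub]

/-! ## §2 Twisted volumes `∫ β(u) • ψ_S(u) dνN(u)`, index-keyed -/

section Volumes

variable [MeasurableSpace (unipDelta L e dV hdV dW hdW)] [BorelSpace (unipDelta L e dV hdV dW hdW)]

omit [BorelSpace (unipDelta L e dV hdV dW hdW)] in
/-- **the volume in covering-weight currency**: `∫ β(u) • 1 dνN = ∫ β dνN` (as a complex number; `β ≤ 1 < ∞` pointwise). [folklore]
[cite: MoeglinWaldspurger1995, I.2.6] -/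
theorem integral_wt_smul_one (νN : Measure (unipDelta L e dV hdV dW hdW)) {β : unipDelta L e dV hdV dW hdW → ℝ≥0∞}
    (hβ : IsCoveringWeight (unipDeltaRat L e dV hdV dW hdW) β) :
    ∫ u, (β u).toReal • (1 : ℂ) ∂νN = (((∫⁻ u, β u ∂νN).toReal : ℝ) : ℂ) := by
  rw [integral_smul_const, integral_toReal hβ.measurable.aemeasurable (ae_of_all _ fun u => lt_of_le_of_lt (hβ.le_one u) ENNReal.one_lt_top),
    Complex.real_smul, mul_one]

omit [BorelSpace (unipDelta L e dV hdV dW hdW)] in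
/-- **an index with `ψ_S ≡ 1` on `N_Δ(𝔸)` has twisted volume `∫ β dνN`** (e.g. `S = 0`, or a hermitian-type `S`, ★ (A1) `unipDeltaChar_eq_one_of_herm`).
[cite: MoeglinWaldspurger1995, I.2.6] [cite: KudlaRallis1994, §2] -/
theorem integral_wt_smul_eq_of_forall_eq_one (νN : Measure (unipDelta L e dV hdV dW hdW)) {β : unipDelta L e dV hdV dW hdW → ℝ≥0∞}
    (hβ : IsCoveringWeight (unipDeltaRat L e dV hdV dW hdW) β) {S : Matrix (Fin n) (Fin n) L}
    (hS1 : ∀ u : unipDelta L e dV hdV dW hdW, unipDeltaChar L e dV hdV dW hdW S (u : HA L e dV hdV dW hdW) = 1) :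
    ∫ u, (β u).toReal • (unipDeltaChar L e dV hdV dW hdW S (u : HA L e dV hdV dW hdW) : ℂ) ∂νN = (((∫⁻ u, β u ∂νN).toReal : ℝ) : ℂ) := by
  simp_rw [hS1, Circle.coe_one]
  exact integral_wt_smul_one L e dV hdV dW hdW νN hβ

omit [BorelSpace (unipDelta L e dV hdV dW hdW)] in
/-- **the zero index: `∫ β(u) • ψ_0(u) dνN = ∫ β dνN`**. [cite: MoeglinWaldspurger1995, I.2.6] [cite: KudlaRallis1994, §2] -/
theorem integral_wt_smul_unipDeltaChar_zero (νN : Measure (unipDelta L e dV hdV dW hdW)) {β : unipDelta L e dV hdV dW hdW → ℝ≥0∞}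
    (hβ : IsCoveringWeight (unipDeltaRat L e dV hdV dW hdW) β) :
    ∫ u, (β u).toReal • (unipDeltaChar L e dV hdV dW hdW 0 (u : HA L e dV hdV dW hdW) : ℂ) ∂νN = (((∫⁻ u, β u ∂νN).toReal : ℝ) : ℂ) :=
  integral_wt_smul_eq_of_forall_eq_one L e dV hdV dW hdW νN hβ fun _ => unipDeltaChar_zero L e dV hdV dW hdW _

/-- **A NON-ZERO RATIONAL SKEW INDEX HAS TWISTED VOLUME ZERO: `∫ β(u) • ψ_S(u) dνN(u) = 0`** (`νN` left-invariant, `β` an `N_Δ(L⁺)`-covering weight,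
`S ∈ Skew_{T_L}(L)`, `S ≠ 0`, `dV i ≠ 0`, `dW i ≠ 0`): ★ (A1) injectivity (★ Φ2 (T2′)) gives `u₀ ∈ N_Δ(𝔸)` with `ψ_S(u₀) ≠ 1`, and ★ (A2)
`integral_wt_smul_unipDeltaChar_eq_zero` («a non-trivial character integrates to zero over the compact quotient», translation by `u₀` + weight
independence) concludes. [cite: MoeglinWaldspurger1995, I.2.6] [cite: Tan1999, §3] [cite: KudlaRallis1994, §2] -/
theorem integral_wt_smul_unipDeltaChar_eq_zero_of_ne_zero (hdV0 : ∀ i, dV i ≠ 0) (hdW0 : ∀ i, dW i ≠ 0)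
    (νN : Measure (unipDelta L e dV hdV dW hdW)) [νN.IsMulLeftInvariant]
    {β : unipDelta L e dV hdV dW hdW → ℝ≥0∞} (hβ : IsCoveringWeight (unipDeltaRat L e dV hdV dW hdW) β) {S : Matrix (Fin n) (Fin n) L}
    (hS : S ∈ skewMatrices ((IsCMField.complexConj L : L ≃ₐ[Fp L] L) : L →+* L) ((gramR L e dV hdV dW hdW).map (algebraMap (Fp L) L)))
    (hS0 : S ≠ 0) :
    ∫ u, (β u).toReal • (unipDeltaChar L e dV hdV dW hdW S (u : HA L e dV hdV dW hdW) : ℂ) ∂νN = 0 := by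
  obtain ⟨u₀, hu₀⟩ := exists_unipDeltaChar_ne_one_of_ne_zero hdV0 hdW0 hS hS0
  exact integral_wt_smul_unipDeltaChar_eq_zero L e dV hdV dW hdW νN hβ S hu₀

/-- **HEADLINE (B3-1). `∫ β(u) • ψ_S(u) dνN(u) = δ_{S,0} · ∫ β dνN`** for a rational `T_L`-skew index `S` (`νN` left-invariant on `N_Δ(𝔸)`, `β` an
`N_Δ(L⁺)`-covering weight, `dV i ≠ 0`, `dW i ≠ 0`): the orthogonality of the unipotent character `ψ_S` to the constants over the compact quotient
`N_Δ(L⁺)\N_Δ(𝔸)`, in covering-weight currency.  (The decidability of `S = 0` is the caller's: `classical`.) [cite: MoeglinWaldspurger1995, I.2.6]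
[cite: Shimura1997, §18.1] [cite: Tan1999, §3] [cite: KudlaRallis1994, §2] -/
theorem integral_coveringWeight_mul_unipDeltaChar (hdV0 : ∀ i, dV i ≠ 0) (hdW0 : ∀ i, dW i ≠ 0)
    (νN : Measure (unipDelta L e dV hdV dW hdW)) [νN.IsMulLeftInvariant]
    {β : unipDelta L e dV hdV dW hdW → ℝ≥0∞} (hβ : IsCoveringWeight (unipDeltaRat L e dV hdV dW hdW) β) {S : Matrix (Fin n) (Fin n) L}
    (hS : S ∈ skewMatrices ((IsCMField.complexConj L : L ≃ₐ[Fp L] L) : L →+* L) ((gramR L e dV hdV dW hdW).map (algebraMap (Fp L) L)))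
    [Decidable (S = 0)] :
    ∫ u, (β u).toReal • (unipDeltaChar L e dV hdV dW hdW S (u : HA L e dV hdV dW hdW) : ℂ) ∂νN =
      if S = 0 then (((∫⁻ u, β u ∂νN).toReal : ℝ) : ℂ) else 0 := by
  by_cases h0 : S = 0
  · rw [if_pos h0]
    subst h0
    exact integral_wt_smul_unipDeltaChar_zero L e dV hdV dW hdW νN hβ
  · rw [if_neg h0]
    exact integral_wt_smul_unipDeltaChar_eq_zero_of_ne_zero L e dV hdV dW hdW hdV0 hdW0 νN hβ hS h0

/-- the headline in the `*`-currency of the deal text: **`∫ β(u) · ψ_S(u) dνN(u) = δ_{S,0} · ∫ β dνN`** (`(β u).toReal • z = ↑(β u).toReal * z`).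
[cite: MoeglinWaldspurger1995, I.2.6] [cite: KudlaRallis1994, §2] -/
theorem integral_coveringWeight_mul_unipDeltaChar' (hdV0 : ∀ i, dV i ≠ 0) (hdW0 : ∀ i, dW i ≠ 0)
    (νN : Measure (unipDelta L e dV hdV dW hdW)) [νN.IsMulLeftInvariant]
    {β : unipDelta L e dV hdV dW hdW → ℝ≥0∞} (hβ : IsCoveringWeight (unipDeltaRat L e dV hdV dW hdW) β) {S : Matrix (Fin n) (Fin n) L}
    (hS : S ∈ skewMatrices ((IsCMField.complexConj L : L ≃ₐ[Fp L] L) : L →+* L) ((gramR L e dV hdV dW hdW).map (algebraMap (Fp L) L)))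
    [Decidable (S = 0)] :
    ∫ u, ((β u).toReal : ℂ) * (unipDeltaChar L e dV hdV dW hdW S (u : HA L e dV hdV dW hdW) : ℂ) ∂νN =
      if S = 0 then (((∫⁻ u, β u ∂νN).toReal : ℝ) : ℂ) else 0 := by
  simp_rw [← Complex.real_smul]
  exact integral_coveringWeight_mul_unipDeltaChar L e dV hdV dW hdW hdV0 hdW0 νN hβ hS

/-- the `conj`-twin (the kernel of ★ (D) `fourierCoeffDelta`): **`∫ β(u) • conj ψ_S(u) dνN(u) = δ_{S,0} · ∫ β dνN`** (`conj ψ_S = ψ_{−S}`, `−S` is skew).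
[cite: MoeglinWaldspurger1995, I.2.6] [cite: KudlaRallis1994, §2] -/
theorem integral_wt_smul_conj_unipDeltaChar (hdV0 : ∀ i, dV i ≠ 0) (hdW0 : ∀ i, dW i ≠ 0)
    (νN : Measure (unipDelta L e dV hdV dW hdW)) [νN.IsMulLeftInvariant]
    {β : unipDelta L e dV hdV dW hdW → ℝ≥0∞} (hβ : IsCoveringWeight (unipDeltaRat L e dV hdV dW hdW) β) {S : Matrix (Fin n) (Fin n) L}
    (hS : S ∈ skewMatrices ((IsCMField.complexConj L : L ≃ₐ[Fp L] L) : L →+* L) ((gramR L e dV hdV dW hdW).map (algebraMap (Fp L) L)))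
    [Decidable (S = 0)] :
    ∫ u, (β u).toReal • conj (unipDeltaChar L e dV hdV dW hdW S (u : HA L e dV hdV dW hdW) : ℂ) ∂νN =
      if S = 0 then (((∫⁻ u, β u ∂νN).toReal : ℝ) : ℂ) else 0 := by
  simp_rw [← coe_unipDeltaChar_neg]
  by_cases h0 : S = 0
  · rw [if_pos h0]
    subst h0
    rw [neg_zero]
    exact integral_wt_smul_unipDeltaChar_zero L e dV hdV dW hdW νN hβ
  · rw [if_neg h0]
    exact integral_wt_smul_unipDeltaChar_eq_zero_of_ne_zero L e dV hdV dW hdW hdV0 hdW0 νN hβ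
      ((skewMatrices _ _).neg_mem hS) (neg_ne_zero.2 h0)

/-! ## §3 Orthogonality relations `⟨ψ_S, ψ_{S'}⟩_β = δ_{S,S'} · ∫ β dνN` -/

/-- **ORTHOGONALITY RELATIONS OF THE UNIPOTENT CHARACTERS: `∫ β(u) • (conj ψ_S(u) · ψ_{S'}(u)) dνN(u) = δ_{S,S'} · ∫ β dνN`** for rational
`T_L`-skew `S, S'` (`νN` left-invariant, `β` an `N_Δ(L⁺)`-covering weight, `dV i ≠ 0`, `dW i ≠ 0`): `conj ψ_S · ψ_{S'} = ψ_{S'−S}` and the headline at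
the skew index `S' − S`.  This is the summand of the unfolding B3-2 (`φ(uh) = Σ_ξ ψ_{S_ξ}(u) c_ξ(h)` integrated against `β • conj ψ_S`).
[cite: MoeglinWaldspurger1995, I.2.6] [cite: Weil1964, n° 13] [cite: Shimura1997, §18.1] -/
theorem integral_wt_smul_conj_unipDeltaChar_mul_unipDeltaChar (hdV0 : ∀ i, dV i ≠ 0) (hdW0 : ∀ i, dW i ≠ 0)
    (νN : Measure (unipDelta L e dV hdV dW hdW)) [νN.IsMulLeftInvariant]
    {β : unipDelta L e dV hdV dW hdW → ℝ≥0∞} (hβ : IsCoveringWeight (unipDeltaRat L e dV hdV dW hdW) β) {S S' : Matrix (Fin n) (Fin n) L}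
    (hS : S ∈ skewMatrices ((IsCMField.complexConj L : L ≃ₐ[Fp L] L) : L →+* L) ((gramR L e dV hdV dW hdW).map (algebraMap (Fp L) L)))
    (hS' : S' ∈ skewMatrices ((IsCMField.complexConj L : L ≃ₐ[Fp L] L) : L →+* L) ((gramR L e dV hdV dW hdW).map (algebraMap (Fp L) L)))
    [Decidable (S = S')] :
    ∫ u, (β u).toReal • (conj (unipDeltaChar L e dV hdV dW hdW S (u : HA L e dV hdV dW hdW) : ℂ) *
        (unipDeltaChar L e dV hdV dW hdW S' (u : HA L e dV hdV dW hdW) : ℂ)) ∂νN =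
      if S = S' then (((∫⁻ u, β u ∂νN).toReal : ℝ) : ℂ) else 0 := by
  simp_rw [conj_unipDeltaChar_mul_unipDeltaChar]
  by_cases h : S = S'
  · rw [if_pos h]
    subst h
    rw [sub_self]
    exact integral_wt_smul_unipDeltaChar_zero L e dV hdV dW hdW νN hβ
  · rw [if_neg h]
    exact integral_wt_smul_unipDeltaChar_eq_zero_of_ne_zero L e dV hdV dW hdW hdV0 hdW0 νN hβ
      ((skewMatrices _ _).sub_mem hS' hS) (sub_ne_zero.2 (Ne.symm h))

/-- **the normalised summand: `(∫ β dνN)⁻¹ • ∫ β(u) • (conj ψ_S(u) · (ψ_{S'}(u) · c)) dνN(u) = δ_{S,S'} · c`** (`0 < ∫ β dνN < ∞`) — the shape in which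
★ (D) `fourierCoeffDelta νN β S φ h` meets a slice `φ(u h) = ψ_{S'}(u) · c`. [cite: MoeglinWaldspurger1995, I.2.6] [cite: Weil1964, n° 13] -/
theorem average_wt_smul_conj_unipDeltaChar_mul_unipDeltaChar_mul (hdV0 : ∀ i, dV i ≠ 0) (hdW0 : ∀ i, dW i ≠ 0)
    (νN : Measure (unipDelta L e dV hdV dW hdW)) [νN.IsMulLeftInvariant]
    {β : unipDelta L e dV hdV dW hdW → ℝ≥0∞} (hβ : IsCoveringWeight (unipDeltaRat L e dV hdV dW hdW) β)
    (hβ0 : ∫⁻ u, β u ∂νN ≠ 0) (hβtop : ∫⁻ u, β u ∂νN ≠ ∞) {S S' : Matrix (Fin n) (Fin n) L}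
    (hS : S ∈ skewMatrices ((IsCMField.complexConj L : L ≃ₐ[Fp L] L) : L →+* L) ((gramR L e dV hdV dW hdW).map (algebraMap (Fp L) L)))
    (hS' : S' ∈ skewMatrices ((IsCMField.complexConj L : L ≃ₐ[Fp L] L) : L →+* L) ((gramR L e dV hdV dW hdW).map (algebraMap (Fp L) L)))
    (c : ℂ) [Decidable (S = S')] :
    ((∫⁻ u, β u ∂νN).toReal⁻¹ : ℝ) •
        ∫ u, (β u).toReal • (conj (unipDeltaChar L e dV hdV dW hdW S (u : HA L e dV hdV dW hdW) : ℂ) *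
          ((unipDeltaChar L e dV hdV dW hdW S' (u : HA L e dV hdV dW hdW) : ℂ) * c)) ∂νN =
      if S = S' then c else 0 := by
  have hI : ∫ u, (β u).toReal • (conj (unipDeltaChar L e dV hdV dW hdW S (u : HA L e dV hdV dW hdW) : ℂ) *
        ((unipDeltaChar L e dV hdV dW hdW S' (u : HA L e dV hdV dW hdW) : ℂ) * c)) ∂νN =
      (∫ u, (β u).toReal • (conj (unipDeltaChar L e dV hdV dW hdW S (u : HA L e dV hdV dW hdW) : ℂ) *
        (unipDeltaChar L e dV hdV dW hdW S' (u : HA L e dV hdV dW hdW) : ℂ)) ∂νN) * c := by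
    rw [← integral_mul_const]
    exact integral_congr_ae (ae_of_all _ fun u => by dsimp only; rw [← mul_assoc, smul_mul_assoc])
  rw [hI, integral_wt_smul_conj_unipDeltaChar_mul_unipDeltaChar L e dV hdV dW hdW hdV0 hdW0 νN hβ hS hS']
  by_cases h : S = S'
  · rw [if_pos h, if_pos h, Complex.real_smul, ← mul_assoc, ← Complex.ofReal_mul,
      inv_mul_cancel₀ (ENNReal.toReal_ne_zero.2 ⟨hβ0, hβtop⟩), Complex.ofReal_one, one_mul]
  · rw [if_neg h, if_neg h, zero_mul, smul_zero]

/-! ## §4 The index-keyed identity cell -/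

/-- **THE IDENTITY CELL, INDEX-KEYED: `φ_S(h) = if S = 0 then φ(h) else 0`** for a left-`N_Δ(𝔸)`-invariant slice (`φ(u h) = φ(h)` for all `u ∈ N_Δ(𝔸)`,
e.g. a Siegel section ★ D9 `apply_unipDelta_mul`), a rational skew index `S`, `νN` left-invariant and an `N_Δ(L⁺)`-covering weight of mass
`0 < ∫ β dνN < ∞` (★ (A2) `fourierCoeffDelta_of_forall_mul_eq_zero ∕ _eq_self` ∘ §1). [cite: KudlaRallis1994, §2] [cite: MoeglinWaldspurger1995, II.1.7] -/
theorem fourierCoeffDelta_of_forall_mul_eq_ite (hdV0 : ∀ i, dV i ≠ 0) (hdW0 : ∀ i, dW i ≠ 0)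
    (νN : Measure (unipDelta L e dV hdV dW hdW)) [νN.IsMulLeftInvariant]
    {β : unipDelta L e dV hdV dW hdW → ℝ≥0∞} (hβ : IsCoveringWeight (unipDeltaRat L e dV hdV dW hdW) β)
    (hβ0 : ∫⁻ u, β u ∂νN ≠ 0) (hβtop : ∫⁻ u, β u ∂νN ≠ ∞) {S : Matrix (Fin n) (Fin n) L}
    (hS : S ∈ skewMatrices ((IsCMField.complexConj L : L ≃ₐ[Fp L] L) : L →+* L) ((gramR L e dV hdV dW hdW).map (algebraMap (Fp L) L)))
    [Decidable (S = 0)] {φ : HA L e dV hdV dW hdW → ℂ} {h : HA L e dV hdV dW hdW}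
    (hφ : ∀ u : unipDelta L e dV hdV dW hdW, φ ((u : HA L e dV hdV dW hdW) * h) = φ h) :
    fourierCoeffDelta L e dV hdV dW hdW νN β S φ h = if S = 0 then φ h else 0 := by
  by_cases h0 : S = 0
  · rw [if_pos h0]
    subst h0
    exact fourierCoeffDelta_of_forall_mul_eq_self L e dV hdV dW hdW νN hβ.measurable hβ.le_one hβ0 hβtop 0
      (fun _ => unipDeltaChar_zero L e dV hdV dW hdW _) hφ
  · rw [if_neg h0]
    obtain ⟨u₀, hu₀⟩ := exists_unipDeltaChar_ne_one_of_ne_zero hdV0 hdW0 hS h0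
    exact fourierCoeffDelta_of_forall_mul_eq_zero L e dV hdV dW hdW νN hβ S hφ hu₀

/-! ## §5 Integrability of weighted bounded slices (the Fubini input of B3-2) -/

omit [BorelSpace (unipDelta L e dV hdV dW hdW)] in
/-- **a bounded a.e.-strongly-measurable slice is integrable against a finite-mass weight**: `u ↦ β(u) • F(u)` is `νN`-integrable when `β` is
measurable with `∫ β dνN < ∞` and `‖F‖ ≤ C` (no compact-support hypothesis on `β`). [folklore] [cite: MoeglinWaldspurger1995, I.2.6] -/
theorem integrable_wt_smul_of_norm_le (νN : Measure (unipDelta L e dV hdV dW hdW)) {β : unipDelta L e dV hdV dW hdW → ℝ≥0∞}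
    (hβm : Measurable β) (hβtop : ∫⁻ u, β u ∂νN ≠ ∞) {F : unipDelta L e dV hdV dW hdW → ℂ} (hFm : AEStronglyMeasurable F νN)
    {C : ℝ} (hC : ∀ u, ‖F u‖ ≤ C) : Integrable (fun u => (β u).toReal • F u) νN := by
  refine Integrable.mono' ((integrable_toReal_of_lintegral_ne_top hβm.aemeasurable hβtop).mul_const C)
    (hβm.ennreal_toReal.aestronglyMeasurable.smul hFm) (Eventually.of_forall fun u => ?_)
  rw [norm_smul, Real.norm_of_nonneg ENNReal.toReal_nonneg]
  exact mul_le_mul_of_nonneg_left (hC u) ENNReal.toReal_nonneg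

/-- **… in particular `u ↦ β(u) • (conj ψ_S(u) · G(u))` is integrable** for a bounded a.e.-strongly-measurable `G` (`|ψ_S| = 1`, `ψ_S` continuous).
[folklore] [cite: MoeglinWaldspurger1995, I.2.6] -/
theorem integrable_wt_smul_conj_unipDeltaChar_mul (νN : Measure (unipDelta L e dV hdV dW hdW)) {β : unipDelta L e dV hdV dW hdW → ℝ≥0∞}
    (hβm : Measurable β) (hβtop : ∫⁻ u, β u ∂νN ≠ ∞) (S : Matrix (Fin n) (Fin n) L) {G : unipDelta L e dV hdV dW hdW → ℂ}
    (hGm : AEStronglyMeasurable G νN) {C : ℝ} (hC : ∀ u, ‖G u‖ ≤ C) :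
    Integrable (fun u => (β u).toReal • (conj (unipDeltaChar L e dV hdV dW hdW S (u : HA L e dV hdV dW hdW) : ℂ) * G u)) νN :=
  integrable_wt_smul_of_norm_le L e dV hdV dW hdW νN hβm hβtop
    (((Complex.continuous_conj.comp (continuous_unipDeltaChar_coe L e dV hdV dW hdW S)).aestronglyMeasurable).mul hGm)
    fun u => (norm_conj_unipDeltaChar_mul L e dV hdV dW hdW S _ _).le.trans (hC u)

end Volumes

end Summit.HodgeConjecture.HodgeConjecture.Cruxes.HLiu418.K2LiuCoveringWeightCharacterOrthogonality

end
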